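import Summits.AtomisticToContinuum.Crystallization.Theorems.PhononSlackCertificatesPeriodicGivenLayeredConvexity1
import Summits.AtomisticToContinuum.Crystallization.Theorems.PhononSlackCertificatesPeriodicGivenLayeredConvexity2
import Summits.AtomisticToContinuum.Crystallization.Theorems.PhononSlackCertificatesPeriodicGivenLayeredConvexity4
import Summits.AtomisticToContinuum.Crystallization.Theorems.PhononSlackCertificatesPeriodicGivenLayeredConvexity5
import Summits.AtomisticToContinuum.Crystallization.Theorems.PhononSlackCertificatesPeriodicGivenLayeredConvexity6
import Literature.MathematicalPhysics.StatisticalMechanics.BarlowStackingEnergy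

/-!
# Increment convexity of the alternating block energy (stub `stub_convexity`)

Stub `stub_convexity` of line `Sketch` of crux `PeriodicGivenLayered` (stmt-AtomisticToContinuum-11779):
the energy of an alternating stack of `n + 1` triangular layers of spacing `a ∈ [47/50, 1]` with free
increments `Δ 0, …, Δ (n-1)` in the box `[39a/50, 17a/20]` — the sum over pairs of layers
`i < j ≤ n` of the interaction `layerInteraction V_LJ a (Δ i + ⋯ + Δ (j-1)) δ 1` of one site of layer
`i` with the whole layer `j` (aligned, `δ = 0`, iff `j - i` is even) — is uniformly midpoint convex in
the increments: `κ ∑ (Δ i - Δ' i)² ≤ F(Δ) + F(Δ') - 2F((Δ+Δ')/2)` with `κ = 1/2`.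

Proof: termwise midpoint defects of the layer terms `V_LJ(√(a²P + H²))` from second-derivative bounds
(`…Convexity2`), summed over the layer (`…Convexity3`); the scaled curvature `a⁻⁸[b v⁸(13t-P) - v⁵(7t-P)]`
is `≥ 113/50` at the three nearest offset sites and bounded by an explicit majorant elsewhere
(`…Convexity4`), whose lattice sums are certified (`…Convexity5`, `…Convexity6`): nearest layers `≥ 6.11`,
spans `k = 2, 3` cost `4·0.5745 + 9·0.0453`, spans `k ≥ 4` cost `≤ 1.0732`; the abstract reduction
(`…Convexity1`, Cauchy–Schwarz + window counting) then gives `κ = (6.11 - 3.78)/4 ≥ 1/2`. [folklore]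
-/

noncomputable section

namespace Summit.AtomisticToContinuum.Crystallization.Theorems.LayeredHull

open scoped BigOperators
open Filter Literature.MathematicalPhysics.StatisticalMechanics

/-- **Midpoint defect of one layer interaction from per-site curvature bounds.** For
`a ∈ [47/50, 1]`, `δ ∈ {0,1}`, span `k ≥ 1` and a summable family `ℓ` of per-site lower bounds of the
scaled curvature on `t ∈ [(0.78k)², (0.85k)²]`, `b ∈ [1, 29/20]`, the layer interaction
`H ↦ layerInteraction V_LJ a H δ 1` satisfies
`(a⁻⁸/4)(∑' ℓ)(h - h')² ≤ Φ(h) + Φ(h') - 2Φ((h+h')/2)` for `h, h' ∈ [0.78ak, 0.85ak]`. [folklore] -/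
theorem cvx_layer_defect (a : ℝ) (ha : 47 / 50 ≤ a) (ha1 : a ≤ 1) (δ : ℤ) (hδ : δ = 0 ∨ δ = 1)
    (k : ℕ) (hk : 1 ≤ k) (ℓ : ℤ × ℤ → ℝ) (hℓ : Summable ℓ)
    (hsite : ∀ p : ℤ × ℤ, ∀ t b : ℝ, (39 / 50 * (k : ℝ)) ^ 2 ≤ t → t ≤ (17 / 20 * (k : ℝ)) ^ 2 →
      1 ≤ b → b ≤ 29 / 20 →
      ℓ p ≤ b * (((((p.1 : ℝ) + p.2 / 2 + δ / 2) ^ 2 + 3 / 4 * ((p.2 : ℝ) + δ / 3) ^ 2) + t)⁻¹) ^ 8 *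
          (13 * t - (((p.1 : ℝ) + p.2 / 2 + δ / 2) ^ 2 + 3 / 4 * ((p.2 : ℝ) + δ / 3) ^ 2)) -
        (((((p.1 : ℝ) + p.2 / 2 + δ / 2) ^ 2 + 3 / 4 * ((p.2 : ℝ) + δ / 3) ^ 2) + t)⁻¹) ^ 5 *
          (7 * t - (((p.1 : ℝ) + p.2 / 2 + δ / 2) ^ 2 + 3 / 4 * ((p.2 : ℝ) + δ / 3) ^ 2)))
    (h h' : ℝ) (hh1 : (k : ℝ) * (39 / 50 * a) ≤ h) (hh2 : h ≤ (k : ℝ) * (17 / 20 * a))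
    (hh1' : (k : ℝ) * (39 / 50 * a) ≤ h') (hh2' : h' ≤ (k : ℝ) * (17 / 20 * a)) :
    (a⁻¹) ^ 8 / 4 * (∑' p, ℓ p) * (h - h') ^ 2 ≤
      layerInteraction lennardJones a h δ 1 + layerInteraction lennardJones a h' δ 1 -
        2 * layerInteraction lennardJones a ((h + h') / 2) δ 1 := by
  have ha0 : 0 < a := by linarith
  have hk1 : (1 : ℝ) ≤ k := by exact_mod_cast hk
  set p₀ := (k : ℝ) * (39 / 50 * a) with hp₀
  set r₀ := (k : ℝ) * (17 / 20 * a) with hr₀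
  have hp₀pos : 0 < p₀ := by positivity
  -- the scaled parameters of a height `x ∈ [p₀, r₀]`
  have hpar : ∀ x ∈ Set.Icc p₀ r₀, 0 < x ∧ (39 / 50 * (k : ℝ)) ^ 2 ≤ x ^ 2 / a ^ 2 ∧
      x ^ 2 / a ^ 2 ≤ (17 / 20 * (k : ℝ)) ^ 2 := by
    intro x hx
    have hx0 : 0 < x := lt_of_lt_of_le hp₀pos hx.1
    have e : x ^ 2 / a ^ 2 = (x / a) ^ 2 := by rw [div_pow]
    rw [e]
    have h1 : 39 / 50 * (k : ℝ) ≤ x / a := by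
      rw [le_div_iff₀ ha0]; linarith [hx.1]
    have h2 : x / a ≤ 17 / 20 * (k : ℝ) := by
      rw [div_le_iff₀ ha0]; linarith [hx.2]
    refine ⟨hx0, pow_le_pow_left₀ (by positivity) h1 2, pow_le_pow_left₀ (div_pos hx0 ha0).le h2 2⟩
  have hb1 : 1 ≤ (a⁻¹) ^ 6 := one_le_pow₀ (one_le_inv₀ ha0 |>.2 ha1)
  have hb2 : (a⁻¹) ^ 6 ≤ 29 / 20 := by
    have : a⁻¹ ≤ 50 / 47 := by rw [inv_le_comm₀ ha0 (by norm_num)]; linarith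
    calc (a⁻¹) ^ 6 ≤ (50 / 47 : ℝ) ^ 6 := pow_le_pow_left₀ (by positivity) this 6
      _ ≤ 29 / 20 := by norm_num
  rw [cvx_layerInteraction_eq a h δ, cvx_layerInteraction_eq a h' δ,
    cvx_layerInteraction_eq a ((h + h') / 2) δ]
  have key := cvx_tsum_defect_lower (ι := ℤ × ℤ) (p := p₀) (r := r₀)
    (f := fun (q : ℤ × ℤ) (x : ℝ) =>
      1 / 12 * ((a ^ 2 * (((q.1 : ℝ) + q.2 / 2 + δ / 2) ^ 2 + 3 / 4 * ((q.2 : ℝ) + δ / 3) ^ 2) +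
        x ^ 2)⁻¹) ^ 6 -
      1 / 6 * ((a ^ 2 * (((q.1 : ℝ) + q.2 / 2 + δ / 2) ^ 2 + 3 / 4 * ((q.2 : ℝ) + δ / 3) ^ 2) +
        x ^ 2)⁻¹) ^ 3)
    (f' := fun (q : ℤ × ℤ) (x : ℝ) =>
      x * ((((a ^ 2 * (((q.1 : ℝ) + q.2 / 2 + δ / 2) ^ 2 + 3 / 4 * ((q.2 : ℝ) + δ / 3) ^ 2) +
        x ^ 2)⁻¹) ^ 4 -
        ((a ^ 2 * (((q.1 : ℝ) + q.2 / 2 + δ / 2) ^ 2 + 3 / 4 * ((q.2 : ℝ) + δ / 3) ^ 2) +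
        x ^ 2)⁻¹) ^ 7)))
    (f'' := fun (q : ℤ × ℤ) (x : ℝ) =>
      ((a ^ 2 * (((q.1 : ℝ) + q.2 / 2 + δ / 2) ^ 2 + 3 / 4 * ((q.2 : ℝ) + δ / 3) ^ 2) +
        x ^ 2)⁻¹) ^ 4 -
      ((a ^ 2 * (((q.1 : ℝ) + q.2 / 2 + δ / 2) ^ 2 + 3 / 4 * ((q.2 : ℝ) + δ / 3) ^ 2) +
        x ^ 2)⁻¹) ^ 7 -
      8 * x ^ 2 * ((a ^ 2 * (((q.1 : ℝ) + q.2 / 2 + δ / 2) ^ 2 + 3 / 4 * ((q.2 : ℝ) + δ / 3) ^ 2) +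
        x ^ 2)⁻¹) ^ 5 +
      14 * x ^ 2 * ((a ^ 2 * (((q.1 : ℝ) + q.2 / 2 + δ / 2) ^ 2 + 3 / 4 * ((q.2 : ℝ) + δ / 3) ^ 2) +
        x ^ 2)⁻¹) ^ 8)
    (ℓ := fun q => (a⁻¹) ^ 8 * ℓ q)
    (fun q x hx => cvx_hasDerivAt_E _ x (by have := (hpar x hx).1; positivity))
    (fun q x hx => cvx_hasDerivAt_E' _ x (by have := (hpar x hx).1; positivity))
    (by
      intro q x hx
      obtain ⟨hx0, ht1, ht2⟩ := hpar x hx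
      set P := ((q.1 : ℝ) + q.2 / 2 + δ / 2) ^ 2 + 3 / 4 * ((q.2 : ℝ) + δ / 3) ^ 2 with hP
      have hP0 : 0 ≤ P := by rw [hP]; positivity
      have hq : 0 < P + x ^ 2 / a ^ 2 := by positivity
      have hs := cvx_site_scale a P x ha0 hq
      rw [hs]
      exact mul_le_mul_of_nonneg_left (hsite q (x ^ 2 / a ^ 2) ((a⁻¹) ^ 6) ht1 ht2 hb1 hb2)
        (by positivity))
    (hℓ.mul_left _)
    (fun x hx => cvx_summable_layerTerm a ha δ hδ x (hpar x hx).1)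
    (h := h) (h' := h') ⟨hh1, hh2⟩ ⟨hh1', hh2'⟩
  rw [tsum_mul_left] at key
  calc (a⁻¹) ^ 8 / 4 * (∑' p, ℓ p) * (h - h') ^ 2
      = (a⁻¹) ^ 8 * (∑' p, ℓ p) / 4 * (h - h') ^ 2 := by ring
    _ ≤ _ := key

/-! ## The per-span defect bounds with certified constants -/

/-- **Span 1 (nearest layers, offset).** For `h, h' ∈ [39a/50, 17a/20]`:
`(a⁻⁸/4)·(339/50 + 828361/10000 - 835053/10000)·(h-h')² ≤ Φ_N(h) + Φ_N(h') - 2Φ_N((h+h')/2)`.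
[folklore] -/
theorem cvx_span_one (a : ℝ) (ha : 47 / 50 ≤ a) (ha1 : a ≤ 1) (h h' : ℝ)
    (hh1 : 39 / 50 * a ≤ h) (hh2 : h ≤ 17 / 20 * a) (hh1' : 39 / 50 * a ≤ h')
    (hh2' : h' ≤ 17 / 20 * a) :
    (a⁻¹) ^ 8 / 4 * (339 / 50 + 828361 / 10000 - 835053 / 10000) * (h - h') ^ 2 ≤
      layerInteraction lennardJones a h 1 1 + layerInteraction lennardJones a h' 1 1 -
        2 * layerInteraction lennardJones a ((h + h') / 2) 1 1 := by
  have ha0 : 0 < a := by linarith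
  obtain ⟨hM1s, hM1le⟩ := cvx_S1
  obtain ⟨hℓ1s, hℓ1ge⟩ := cvx_ell_tsum_of hM1s hM1le cvx_near_three
  have hdef := cvx_layer_defect a ha ha1 1 (Or.inr rfl) 1 le_rfl _ hℓ1s (by
    intro p t b ht1 ht2 hb1 hb2
    norm_num at ht1 ht2
    split_ifs with hp
    · -- the three nearest sites have `P = 1/3`
      simp only [Finset.mem_insert, Finset.mem_singleton] at hp
      have hnear := cvx_site_near t b ht1 ht2 hb1
      rcases hp with hp | hp | hp <;>
      · rw [hp]
        push_cast
        norm_num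
        norm_num at hnear
        linarith
    · push_cast
      have := cvx_site_far (((p.1 : ℝ) + p.2 / 2 + ((1 : ℤ) : ℝ) / 2) ^ 2 + 3 / 4 * ((p.2 : ℝ) + ((1 : ℤ) : ℝ) / 3) ^ 2) (1521 / 2500) (289 / 400) t b
        (by positivity) (by norm_num) ht1 ht2 (by linarith) hb2
      push_cast at this
      linarith) h h' (by simpa using hh1) (by simpa using hh2) (by simpa using hh1')
      (by simpa using hh2')
  have hsq : 0 ≤ (h - h') ^ 2 := sq_nonneg _
  have hfac : 0 ≤ (a⁻¹) ^ 8 / 4 := by positivity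
  calc (a⁻¹) ^ 8 / 4 * (339 / 50 + 828361 / 10000 - 835053 / 10000) * (h - h') ^ 2
      ≤ (a⁻¹) ^ 8 / 4 * (∑' p, ((if p ∈ ({(0, 0), (-1, 0), (0, -1)} : Finset (ℤ × ℤ)) then
          _ else 0) - _)) * (h - h') ^ 2 := by
        apply mul_le_mul_of_nonneg_right _ hsq
        exact mul_le_mul_of_nonneg_left hℓ1ge hfac
    _ ≤ _ := hdef

/-- **Span 2 (aligned layers).** For `h, h' ∈ [2·39a/50, 2·17a/20]`:
`-(a⁻⁸/4)(1149/2000)(h-h')² ≤ Φ_A(h) + Φ_A(h') - 2Φ_A((h+h')/2)`. [folklore] -/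
theorem cvx_span_two (a : ℝ) (ha : 47 / 50 ≤ a) (ha1 : a ≤ 1) (h h' : ℝ)
    (hh1 : ((2 : ℕ) : ℝ) * (39 / 50 * a) ≤ h) (hh2 : h ≤ ((2 : ℕ) : ℝ) * (17 / 20 * a))
    (hh1' : ((2 : ℕ) : ℝ) * (39 / 50 * a) ≤ h') (hh2' : h' ≤ ((2 : ℕ) : ℝ) * (17 / 20 * a)) :
    -((a⁻¹) ^ 8 / 4 * (1149 / 2000) * (h - h') ^ 2) ≤
      layerInteraction lennardJones a h 0 1 + layerInteraction lennardJones a h' 0 1 -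
        2 * layerInteraction lennardJones a ((h + h') / 2) 0 1 := by
  have ha0 : 0 < a := by linarith
  obtain ⟨hM2s, hM2le⟩ := cvx_S2
  have hdef := cvx_layer_defect a ha ha1 0 (Or.inl rfl) 2 (by norm_num) _ hM2s.neg (by
    intro p t b ht1 ht2 hb1 hb2
    norm_num at ht1 ht2
    exact cvx_site_far _ (1521 / 625) (289 / 100) t b (by positivity) (by norm_num) ht1 ht2
      (by linarith) hb2) h h' hh1 hh2 hh1' hh2'
  rw [tsum_neg] at hdef
  have hsq : 0 ≤ (h - h') ^ 2 := sq_nonneg _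
  have hfac : 0 ≤ (a⁻¹) ^ 8 / 4 := by positivity
  calc -((a⁻¹) ^ 8 / 4 * (1149 / 2000) * (h - h') ^ 2)
      = (a⁻¹) ^ 8 / 4 * (-(1149 / 2000)) * (h - h') ^ 2 := by ring
    _ ≤ (a⁻¹) ^ 8 / 4 * (-(∑' p : ℤ × ℤ, _)) * (h - h') ^ 2 := by
        apply mul_le_mul_of_nonneg_right _ hsq
        exact mul_le_mul_of_nonneg_left (by linarith [hM2le]) hfac
    _ ≤ _ := hdef

/-- **Span 3 (offset layers).** For `h, h' ∈ [3·39a/50, 3·17a/20]`: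
`-(a⁻⁸/4)(453/10000)(h-h')² ≤ Φ_N(h) + Φ_N(h') - 2Φ_N((h+h')/2)`. [folklore] -/
theorem cvx_span_three (a : ℝ) (ha : 47 / 50 ≤ a) (ha1 : a ≤ 1) (h h' : ℝ)
    (hh1 : ((3 : ℕ) : ℝ) * (39 / 50 * a) ≤ h) (hh2 : h ≤ ((3 : ℕ) : ℝ) * (17 / 20 * a))
    (hh1' : ((3 : ℕ) : ℝ) * (39 / 50 * a) ≤ h') (hh2' : h' ≤ ((3 : ℕ) : ℝ) * (17 / 20 * a)) :
    -((a⁻¹) ^ 8 / 4 * (453 / 10000) * (h - h') ^ 2) ≤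
      layerInteraction lennardJones a h 1 1 + layerInteraction lennardJones a h' 1 1 -
        2 * layerInteraction lennardJones a ((h + h') / 2) 1 1 := by
  have ha0 : 0 < a := by linarith
  obtain ⟨hM3s, hM3le⟩ := cvx_S3
  have hdef := cvx_layer_defect a ha ha1 1 (Or.inr rfl) 3 (by norm_num) _ hM3s.neg (by
    intro p t b ht1 ht2 hb1 hb2
    norm_num at ht1 ht2
    exact cvx_site_far _ (13689 / 2500) (2601 / 400) t b (by positivity) (by norm_num) ht1 ht2
      (by linarith) hb2) h h' hh1 hh2 hh1' hh2'
  rw [tsum_neg] at hdef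
  have hsq : 0 ≤ (h - h') ^ 2 := sq_nonneg _
  have hfac : 0 ≤ (a⁻¹) ^ 8 / 4 := by positivity
  calc -((a⁻¹) ^ 8 / 4 * (453 / 10000) * (h - h') ^ 2)
      = (a⁻¹) ^ 8 / 4 * (-(453 / 10000)) * (h - h') ^ 2 := by ring
    _ ≤ (a⁻¹) ^ 8 / 4 * (-(∑' p : ℤ × ℤ, _)) * (h - h') ^ 2 := by
        apply mul_le_mul_of_nonneg_right _ hsq
        exact mul_le_mul_of_nonneg_left (by linarith [hM3le]) hfac
    _ ≤ _ := hdef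

/-- **Spans `k ≥ 4` (analytic regime, either parity).** For `h, h' ∈ [k·39a/50, k·17a/20]` and
`T = (39k/50)²`: `-(a⁻⁸/4)·(141/20)(9T⁻⁴ + (64/21)T⁻³)·(h-h')² ≤ Φ_δ(h) + Φ_δ(h') - 2Φ_δ((h+h')/2)`.
[folklore] -/
theorem cvx_span_ge_four (a : ℝ) (ha : 47 / 50 ≤ a) (ha1 : a ≤ 1) (δ : ℤ) (hδ : δ = 0 ∨ δ = 1)
    (k : ℕ) (hk : 4 ≤ k) (h h' : ℝ)
    (hh1 : (k : ℝ) * (39 / 50 * a) ≤ h) (hh2 : h ≤ (k : ℝ) * (17 / 20 * a))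
    (hh1' : (k : ℝ) * (39 / 50 * a) ≤ h') (hh2' : h' ≤ (k : ℝ) * (17 / 20 * a)) :
    -((a⁻¹) ^ 8 / 4 * (141 / 20 * (9 * (((39 / 50 * (k : ℝ)) ^ 2)⁻¹) ^ 4 +
        64 / 21 * (((39 / 50 * (k : ℝ)) ^ 2)⁻¹) ^ 3)) * (h - h') ^ 2) ≤
      layerInteraction lennardJones a h δ 1 + layerInteraction lennardJones a h' δ 1 -
        2 * layerInteraction lennardJones a ((h + h') / 2) δ 1 := by
  have ha0 : 0 < a := by linarith
  have hk4' : (4 : ℝ) ≤ k := by exact_mod_cast hk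
  set T : ℝ := (39 / 50 * (k : ℝ)) ^ 2 with hT
  have hT15 : 15 / 2 ≤ T := by rw [hT]; nlinarith
  have hTpos : 0 < T := by linarith
  have hC : 7 + 29 / 20 * 13 * (T⁻¹) ^ 3 ≤ 141 / 20 := by
    have : T⁻¹ ≤ 2 / 15 := by
      rw [inv_le_comm₀ hTpos (by norm_num)]; linarith
    have h3 : (T⁻¹) ^ 3 ≤ (2 / 15) ^ 3 := pow_le_pow_left₀ (by positivity) this 3
    linarith [h3]
  obtain ⟨hAs, hAle⟩ := cvx_tsum_analytic δ hδ T hT15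
  have hdef := cvx_layer_defect a ha ha1 δ hδ k (by omega) _ hAs.neg (by
    intro p t b ht1 ht2 hb1 hb2
    exact cvx_site_analytic _ T t b (141 / 20) (by positivity) hTpos ht1 (by linarith) hb2 hC)
    h h' hh1 hh2 hh1' hh2'
  rw [tsum_neg] at hdef
  have hsq : 0 ≤ (h - h') ^ 2 := sq_nonneg _
  have hfac : 0 ≤ (a⁻¹) ^ 8 / 4 := by positivity
  calc -((a⁻¹) ^ 8 / 4 * (141 / 20 * (9 * (T⁻¹) ^ 4 + 64 / 21 * (T⁻¹) ^ 3)) * (h - h') ^ 2)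
      = (a⁻¹) ^ 8 / 4 * (-(141 / 20 * (9 * (T⁻¹) ^ 4 + 64 / 21 * (T⁻¹) ^ 3))) * (h - h') ^ 2 := by
        ring
    _ ≤ (a⁻¹) ^ 8 / 4 * (-(∑' p : ℤ × ℤ, _)) * (h - h') ^ 2 := by
        apply mul_le_mul_of_nonneg_right _ hsq
        exact mul_le_mul_of_nonneg_left (by linarith [hAle]) hfac
    _ ≤ _ := hdef

/-- **The span series with the certified constants**: with `s' 2 = 1149/2000`, `s' 3 = 453/10000` and
`s' k = (141/20)(9T_k⁻⁴ + (64/21)T_k⁻³)` for `k ≥ 4` (`T_k = (39k/50)²`),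
`∑_{2 ≤ k ≤ n} k² s' k ≤ 4·(1149/2000) + 9·(453/10000) + 2683/2500`. [folklore] -/
theorem cvx_span_series (n : ℕ) :
    ∑ k ∈ Finset.Icc 2 n, (k : ℝ) ^ 2 *
      (if k = 2 then (1149 / 2000 : ℝ) else if k = 3 then 453 / 10000 else
        141 / 20 * (9 * (((39 / 50 * (k : ℝ)) ^ 2)⁻¹) ^ 4 +
          64 / 21 * (((39 / 50 * (k : ℝ)) ^ 2)⁻¹) ^ 3)) ≤
      4 * (1149 / 2000) + 9 * (453 / 10000) + 2683 / 2500 := by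
  set s' : ℕ → ℝ := fun k => if k = 2 then (1149 / 2000 : ℝ) else if k = 3 then 453 / 10000 else
    141 / 20 * (9 * (((39 / 50 * (k : ℝ)) ^ 2)⁻¹) ^ 4 + 64 / 21 * (((39 / 50 * (k : ℝ)) ^ 2)⁻¹) ^ 3)
    with hs'
  have hs'0 : ∀ k, 0 ≤ s' k := by
    intro k; simp only [hs']; split_ifs <;> positivity
  show ∑ k ∈ Finset.Icc 2 n, (k : ℝ) ^ 2 * s' k ≤ _
  -- enlarge to `[2, max n 4]` and split off `k = 2, 3`
  set n' := max n 4 with hn'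
  have hn4 : 4 ≤ n' := le_max_right _ _
  have hmono : ∑ k ∈ Finset.Icc 2 n, (k : ℝ) ^ 2 * s' k ≤
      ∑ k ∈ Finset.Icc 2 n', (k : ℝ) ^ 2 * s' k :=
    Finset.sum_le_sum_of_subset_of_nonneg (Finset.Icc_subset_Icc le_rfl (le_max_left _ _))
      fun k _ _ => mul_nonneg (sq_nonneg _) (hs'0 k)
  have hs2 : s' 2 = 1149 / 2000 := by simp [hs']
  have hs3 : s' 3 = 453 / 10000 := by simp [hs']
  have htail : ∑ k ∈ Finset.Icc 4 n', (k : ℝ) ^ 2 * s' k ≤ 2683 / 2500 := by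
    have heq : ∀ k ∈ Finset.Icc 4 n', (k : ℝ) ^ 2 * s' k = (k : ℝ) ^ 2 *
        (141 / 20 * (9 * (((39 / 50 * (k : ℝ)) ^ 2)⁻¹) ^ 4 +
          64 / 21 * (((39 / 50 * (k : ℝ)) ^ 2)⁻¹) ^ 3)) := by
      intro k hk
      rw [Finset.mem_Icc] at hk
      simp only [hs']
      rw [if_neg (by omega), if_neg (by omega)]
    rw [Finset.sum_congr rfl heq]
    exact cvx_series_bound n'
  have hsplit : ∑ k ∈ Finset.Icc 2 n', (k : ℝ) ^ 2 * s' k =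
      (2 : ℝ) ^ 2 * s' 2 + ((3 : ℝ) ^ 2 * s' 3 + ∑ k ∈ Finset.Icc 4 n', (k : ℝ) ^ 2 * s' k) := by
    rw [← Finset.insert_Icc_add_one_left_eq_Icc (show 2 ≤ n' by omega),
      Finset.sum_insert (by simp),
      ← Finset.insert_Icc_add_one_left_eq_Icc (show 2 + 1 ≤ n' by omega),
      Finset.sum_insert (by simp)]
    push_cast
    rfl
  rw [hsplit, hs2, hs3] at hmono
  linarith

/-- **Stub 5 (increment convexity).** The energy of an alternating stack of `n + 1` triangular layers of
spacing `a` with increments `Δ 0, …, Δ (n-1)` — the sum over pairs of layers `i < j ≤ n` of the interaction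
of one site of layer `i` with the whole layer `j` (aligned iff `j − i` is even) — is uniformly midpoint-convex
in the increments on the box `[39a/50, 17a/20]`, uniformly in `n` and in `a ∈ [47/50, 1]`: diagonal dominance
of the interlayer Hessian (certified numerics: nearest-layer curvature budget `≥ 6.11` against
`∑_{k≥2} k² s_k ≤ 3.78`). [folklore] -/
theorem stub_convexity :
    ∃ κ : ℝ, 0 < κ ∧ ∀ a : ℝ, 47 / 50 ≤ a → a ≤ 1 → ∀ (n : ℕ) (Δ Δ' : ℕ → ℝ),
      (∀ i, i < n → 39 / 50 * a ≤ Δ i ∧ Δ i ≤ 17 / 20 * a) →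
      (∀ i, i < n → 39 / 50 * a ≤ Δ' i ∧ Δ' i ≤ 17 / 20 * a) →
      κ * ∑ i ∈ Finset.range n, (Δ i - Δ' i) ^ 2 ≤
        (∑ i ∈ Finset.range n, ∑ j ∈ Finset.Ioc i n, layerInteraction lennardJones a
            (∑ l ∈ Finset.Ico i j, Δ l) (if Even (j - i) then 0 else 1) 1) +
        (∑ i ∈ Finset.range n, ∑ j ∈ Finset.Ioc i n, layerInteraction lennardJones a
            (∑ l ∈ Finset.Ico i j, Δ' l) (if Even (j - i) then 0 else 1) 1) -
        2 * (∑ i ∈ Finset.range n, ∑ j ∈ Finset.Ioc i n, layerInteraction lennardJones a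
            (∑ l ∈ Finset.Ico i j, (Δ l + Δ' l) / 2) (if Even (j - i) then 0 else 1) 1) := by
  refine ⟨1 / 2, by norm_num, ?_⟩
  intro a ha ha1 n Δ Δ' hΔ hΔ'
  have ha0 : 0 < a := by linarith
  have ha8 : 1 ≤ (a⁻¹) ^ 8 := one_le_pow₀ (one_le_inv₀ ha0 |>.2 ha1)
  -- the pair functions (kept opaque, with their defining equation)
  obtain ⟨ψ, hψ⟩ : ∃ ψ : ℕ → ℝ → ℝ,
      ∀ k H, ψ k H = layerInteraction lennardJones a H (if Even k then 0 else 1) 1 :=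
    ⟨fun k H => layerInteraction lennardJones a H (if Even k then 0 else 1) 1, fun _ _ => rfl⟩
  -- the off-diagonal weights (without the common factor `a⁻⁸/4`)
  set s' : ℕ → ℝ := fun k => if k = 2 then (1149 / 2000 : ℝ) else if k = 3 then 453 / 10000 else
    141 / 20 * (9 * (((39 / 50 * (k : ℝ)) ^ 2)⁻¹) ^ 4 + 64 / 21 * (((39 / 50 * (k : ℝ)) ^ 2)⁻¹) ^ 3)
    with hs'
  have hs'0 : ∀ k, 0 ≤ s' k := by
    intro k; simp only [hs']; split_ifs <;> positivity
  -- (1) nearest layers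
  have h1 : ∀ h h' : ℝ, 39 / 50 * a ≤ h → h ≤ 17 / 20 * a → 39 / 50 * a ≤ h' → h' ≤ 17 / 20 * a →
      (a⁻¹) ^ 8 / 4 * (339 / 50 + 828361 / 10000 - 835053 / 10000) * (h - h') ^ 2 ≤
        ψ 1 h + ψ 1 h' - 2 * ψ 1 ((h + h') / 2) := by
    intro h h' hh1 hh2 hh1' hh2'
    have e1 : ∀ H, ψ 1 H = layerInteraction lennardJones a H 1 1 := fun H => by
      rw [hψ]; simp
    rw [e1, e1, e1]
    exact cvx_span_one a ha ha1 h h' hh1 hh2 hh1' hh2'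
  -- (2) longer spans
  have h2 : ∀ k : ℕ, 2 ≤ k → ∀ h h' : ℝ, (k : ℝ) * (39 / 50 * a) ≤ h → h ≤ k * (17 / 20 * a) →
      (k : ℝ) * (39 / 50 * a) ≤ h' → h' ≤ k * (17 / 20 * a) →
      -((a⁻¹) ^ 8 / 4 * s' k * (h - h') ^ 2) ≤ ψ k h + ψ k h' - 2 * ψ k ((h + h') / 2) := by
    intro k hk h h' hh1 hh2 hh1' hh2'
    rcases Nat.lt_or_ge k 4 with hk4 | hk4
    · interval_cases k
      · have e2 : ∀ H, ψ 2 H = layerInteraction lennardJones a H 0 1 := fun H => by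
          rw [hψ]; simp
        have hs2 : s' 2 = 1149 / 2000 := by simp [hs']
        rw [e2, e2, e2, hs2]
        exact cvx_span_two a ha ha1 h h' hh1 hh2 hh1' hh2'
      · have e3 : ∀ H, ψ 3 H = layerInteraction lennardJones a H 1 1 := fun H => by
          rw [hψ]; simp [show ¬ Even 3 by decide]
        have hs3 : s' 3 = 453 / 10000 := by simp [hs']
        rw [e3, e3, e3, hs3]
        exact cvx_span_three a ha ha1 h h' hh1 hh2 hh1' hh2'
    · have hδ : (if Even k then (0 : ℤ) else 1) = 0 ∨ (if Even k then (0 : ℤ) else 1) = 1 := by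
        split_ifs <;> simp
      have hsk : s' k = 141 / 20 * (9 * (((39 / 50 * (k : ℝ)) ^ 2)⁻¹) ^ 4 +
          64 / 21 * (((39 / 50 * (k : ℝ)) ^ 2)⁻¹) ^ 3) := by
        simp only [hs']
        rw [if_neg (by omega), if_neg (by omega)]
      rw [hψ, hψ, hψ, hsk]
      exact cvx_span_ge_four a ha ha1 _ hδ k hk4 h h' hh1 hh2 hh1' hh2'
  -- (3) signs and the span series
  have hs : ∀ k, 2 ≤ k → 0 ≤ (a⁻¹) ^ 8 / 4 * s' k := fun k _ => mul_nonneg (by positivity) (hs'0 k)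
  have hS : ∀ n : ℕ, ∑ k ∈ Finset.Icc 2 n, (k : ℝ) ^ 2 * ((a⁻¹) ^ 8 / 4 * s' k) ≤
      (a⁻¹) ^ 8 / 4 * (4 * (1149 / 2000) + 9 * (453 / 10000) + 2683 / 2500) := by
    intro n
    have hsum := cvx_span_series n
    calc ∑ k ∈ Finset.Icc 2 n, (k : ℝ) ^ 2 * ((a⁻¹) ^ 8 / 4 * s' k)
        = (a⁻¹) ^ 8 / 4 * ∑ k ∈ Finset.Icc 2 n, (k : ℝ) ^ 2 * s' k := by
          rw [Finset.mul_sum]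
          exact Finset.sum_congr rfl fun k _ => by ring
      _ ≤ (a⁻¹) ^ 8 / 4 * (4 * (1149 / 2000) + 9 * (453 / 10000) + 2683 / 2500) :=
          mul_le_mul_of_nonneg_left hsum (by positivity)
  -- (4) the abstract reduction
  have main := cvx_reduction ψ (39 / 50 * a) (17 / 20 * a)
    ((a⁻¹) ^ 8 / 4 * (339 / 50 + 828361 / 10000 - 835053 / 10000))
    ((a⁻¹) ^ 8 / 4 * (4 * (1149 / 2000) + 9 * (453 / 10000) + 2683 / 2500))
    (fun k => (a⁻¹) ^ 8 / 4 * s' k) h1 h2 hs hS n Δ Δ' hΔ hΔ'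
  have hy : 0 ≤ ∑ i ∈ Finset.range n, (Δ i - Δ' i) ^ 2 := Finset.sum_nonneg fun i _ => sq_nonneg _
  have hκ : (1 / 2 : ℝ) ≤ (a⁻¹) ^ 8 / 4 * (339 / 50 + 828361 / 10000 - 835053 / 10000) -
      (a⁻¹) ^ 8 / 4 * (4 * (1149 / 2000) + 9 * (453 / 10000) + 2683 / 2500) := by
    nlinarith [ha8]
  calc 1 / 2 * ∑ i ∈ Finset.range n, (Δ i - Δ' i) ^ 2
      ≤ ((a⁻¹) ^ 8 / 4 * (339 / 50 + 828361 / 10000 - 835053 / 10000) -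
          (a⁻¹) ^ 8 / 4 * (4 * (1149 / 2000) + 9 * (453 / 10000) + 2683 / 2500)) *
          ∑ i ∈ Finset.range n, (Δ i - Δ' i) ^ 2 := mul_le_mul_of_nonneg_right hκ hy
    _ ≤ _ := by
        simp only [← hψ]
        exact main

end Summit.AtomisticToContinuum.Crystallization.Theorems.LayeredHull

end
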